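import Summits.QuantumFields.BalabanUV.Beta.FP.StencilMoments
import Literature.MathematicalPhysics.QuantumFieldTheory.Balaban1983to89.Beta.WindowIdentification

/-!
# `BalabanUV.Beta.FP.FarRegionMoment` — road «FP» (binder row D1), remainder `ρ_n` of the H′ bookkeeping, owner memo `RHOA-DESIGN.md` §3 (F-PC) ∕ §5 row
# RHOA-4 «FAR-REGION MOMENT», PART 1 = (a): THE n-FREE FAR SECOND MOMENT FROM THE GRADED SHELL SHAPE ([folklore] shell sums on `ℤ⁴`;
# G-an2-4 formalisation swarm, unit `b2b-balaban-gan24-formalise-leaf-06`, gen 32, cross-lane idle-seat brick while `GAN24/Formal/LEAVES.md` v3.32 has width 0)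

HONEST DEPENDENCY (page 1, mandatory): continuum YM on T⁴ ⇐ BetaPertH ∧ nine spine estimates (0/9 proved); BetaPertH ⇐ (D1) ∧ (D4) ∧
CAP+tail; G-an2-4 gates asym, D1 and NE2/3/4.  HONEST FRAMING (cell contract, verbatim): «discharging `BetaPertH` makes Bałaban's UV
stability UNCONDITIONAL — a real constructive-QFT result; it is NOT the continuum limit and NOT the Clay problem.»  THIS MODULE is elementary
[folklore] real analysis on `ℤ⁴` over the tree's shell machinery BY NAME (`WindowInterface.tail_sum_le_exp` — `#shell ≤ 80(r+1)³` + the geometric sum;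
`WindowIdentification.psum ∕ fullSum ∕ abs_fullSum_sub_psum_le`; `StencilMoments.pow_succ_mul_exp_le'`); it asserts nothing about Bałaban's objects, cites nothing,
mints no `Prop` fact, has no `def`, 0 sorry.  The far-region SHAPE of the kernel is a HYPOTHESIS displayed in the signatures; producing it for the one-shot kernel
`Π_n` of the H′ route is RHOA-4 (b) + rows IR-5∕IR-6 of `LEAVES-FP.md`, NOT here.  NOT `hbook`, NOT `ρ_n = O(1)`, NOT D1, NOT BetaPertH, NOT continuum, NOT Clay.
ROW (owner b2b-balaban-beta-d1-p3-g6, `RHOA-DESIGN.md` 9c8423e71fecf50d): §3 (F-PC) «FAR `‖z‖ > n`: `Σ_{‖z‖>n}|Π_n(z)|‖z‖² ≤ C`»; §5 RHOA-4 (a) «`|Π(z)| ≤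
C‖z‖∞⁻⁶·e^{−δ‖z‖/n}·(1+‖z‖/n)^b` (or `min(1,(n/‖z‖)^a)`) ⟹ `Σ_{‖z‖∞>n}|Π(z)|‖z‖² ≤ C′` n-FREE (shell sums)».
CONTENT (currency of the consumer `FP/HorizontalTailAssemblyDefect` p238191: `fun z ↦ P z * (z μ : ℝ) * (z ν : ℝ)`, `DyadicShell.supNorm`, blocking `n ≥ 1`; the n-free
constant is DISPLAYED, `E := C·(b!·e^{δ/2}·(2/δ)^b)`, bound `80·E·(1 + 2/δ)`):
* §1 `poly_exp_le`: `(1 + s/n)^b·e^{−(δ/n)s} ≤ (b!·e^{δ/2}·(2/δ)^b)·e^{−(δ/2/n)s}` — the polynomial growth two gradients of graded legs produce costs half the rate, n-free;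
* §2 **`shellBound_of_farShape`**: far shape ⟹ `∀ r ≥ n, ∀ z ∈ annulus 4 r (r+1), |P z·z_μ·z_ν| ≤ E/(r+1)⁴·e^{−(δ/2/n)(r+1)}` — LITERALLY the (W3a) ∕ `htail` shell
  currency of `WindowInterface.tail_sum_le_exp` ∕ `RepAssembly.hrep_of_basePoint` with `(δ, Lr, M) := (δ/2, n, n)`;
* §3 generic: a UNIFORM bound `B` on the far annular sums `Σ_{annulus 4 n R}|f|` gives `Summable f` (`summable_of_far_sum_le`; the near part is a finite sum),
  `|Σ'_{‖z‖∞>n} f| ≤ B` (`abs_tsum_far_le_of_far_sum_le`) and the near∕far split `Σ' f = Σ_{box 4 n} f + Σ'_{‖z‖∞>n} f` (`tsum_eq_sum_box_add_tsum_far`);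
* §4 **`sum_far_abs_le`**: `∀ R ≥ n, Σ_{annulus 4 n R}|P z·z_μ·z_ν| ≤ 80·E·(1 + 2/δ)` — n-FREE; **`summable_moment`** (`Summable (P·z_μ·z_ν)`, the RHOA-5 `hT`-type
  letter for ANY kernel with an F-PC tail), **`abs_tsum_far_le`** (`|Σ'_{‖z‖∞>n} P z·z_μ·z_ν| ≤ 80·E·(1 + 2/δ)`), `abs_fullSum_sub_psum_le_far` (an2's window currency);
* §5 the POWER variant (`1 ≤ a`): `|P z| ≤ C‖z‖∞⁻⁶·(n/‖z‖∞)^a` beyond the window ⟹ `Σ_{annulus 4 n R}|P z·z_μ·z_ν| ≤ 80·C` (telescoping `Σ_{r≥n} n/(r(r+1)) ≤ 1`)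
  + the same corollaries; fractional `0 < a < 1` NOT covered.
Provenance: leaf prover 06 (gen 32), 2026-08-20; «not in print; our bookkeeping»; no existing file touched.
-/

noncomputable section

namespace Summit.QuantumFields.BalabanUV.Beta.FP.FarRegionMoment

open Finset Filter Topology
open scoped BigOperators
open Literature.Probability.LatticeModels (box annulus box_mono)
open Literature.MathematicalPhysics.QuantumFieldTheory.Balaban1983to89.Beta
open Literature.MathematicalPhysics.QuantumFieldTheory.Balaban1983to89.Beta.DyadicShell (Pt supNorm natAbs_le_supNorm mem_annulus_iff
  mem_box_iff supNorm_eq_of_mem_sphere sum_Ico_shellSum)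
open Literature.MathematicalPhysics.QuantumFieldTheory.Balaban1983to89.Beta.WindowLog (shellSum)
open Literature.MathematicalPhysics.QuantumFieldTheory.Balaban1983to89.Beta.TransferUV (card_annulus_succ_four_le)
open Literature.MathematicalPhysics.QuantumFieldTheory.Balaban1983to89.Beta.WindowInterface (tail_sum_le_exp)
open Literature.MathematicalPhysics.QuantumFieldTheory.Balaban1983to89.Beta.WindowIdentification (psum fullSum abs_fullSum_sub_psum_le
  tendsto_box_atTop)
open Summit.QuantumFields.BalabanUV.Beta.FP.StencilMoments (pow_succ_mul_exp_le')

/-! ## §1 The polynomial factor is absorbed into half the exponential rate, uniformly in `n` -/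

/-- [folklore] `(1 + s/n)^b · e^{−(δ/n)s} ≤ (b!·e^{δ/2}·(2/δ)^b) · e^{−(δ/2/n)s}` for `s ≥ 0`, `δ > 0`, `n > 0`
(`StencilMoments.pow_succ_mul_exp_le'` at `L := s/n`). -/
theorem poly_exp_le (b : ℕ) {δ : ℝ} (hδ : 0 < δ) {n : ℕ} (hn : 0 < n) {s : ℝ} (hs : 0 ≤ s) :
    (1 + s / n) ^ b * Real.exp (-(δ / n) * s)
      ≤ ((b.factorial : ℝ) * Real.exp (δ / 2) * (2 / δ) ^ b) * Real.exp (-(δ / 2 / n) * s) := by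
  have hn' : (0 : ℝ) < n := by exact_mod_cast hn
  have hL : 0 ≤ s / n := div_nonneg hs hn'.le
  have h := pow_succ_mul_exp_le' b hδ hL
  have e1 : -(δ / n) * s = -δ * (s / n) := by field_simp
  have e2 : -(δ / 2 / n) * s = -(δ / 2) * (s / n) := by field_simp
  rw [add_comm, e1, e2]
  exact h

/-! ## §2 The far shape in the shell currency of `WindowInterface.tail_sum_le_exp` -/

section Shape

variable {P : Pt → ℝ} {C δ : ℝ} {n b : ℕ}

/-- [folklore] Coordinates on the shell `annulus 4 r (r+1)` are bounded by `r + 1`. -/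
theorem abs_cast_apply_le_of_mem_shell {r : ℕ} {z : Pt} (hz : z ∈ annulus 4 r (r + 1)) (i : Fin 4) :
    |(z i : ℝ)| ≤ (r : ℝ) + 1 := by
  have hs : supNorm z = r + 1 := supNorm_eq_of_mem_sphere hz
  have h1 : (z i).natAbs ≤ r + 1 := hs ▸ natAbs_le_supNorm z i
  have e : |(z i : ℝ)| = ((z i).natAbs : ℝ) := by
    rw [← Int.cast_abs, Int.abs_eq_natAbs]; simp
  rw [e]
  exact_mod_cast h1

/-- [folklore] **THE FAR SHAPE IN SHELL CURRENCY.**  If beyond the window `‖z‖∞ > n` the kernel obeys the graded exponential shape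
`|P z| ≤ C‖z‖∞⁻⁶ · e^{−(δ/n)‖z‖∞} · (1 + ‖z‖∞/n)^b`, then its second-moment integrand obeys, on every shell `‖z‖∞ = r+1` with `r ≥ n`,
`|P z·z_μ·z_ν| ≤ E/(r+1)⁴ · e^{−(δ/2/n)(r+1)}` with `E := C·(b!·e^{δ/2}·(2/δ)^b)` — the hypothesis of `WindowInterface.tail_sum_le_exp` with
`(E, δ, Lr, M) := (E, δ/2, n, n)`. -/
theorem shellBound_of_farShape (hδ : 0 < δ) (hn : 1 ≤ n)
    (hfar : ∀ z : Pt, n < supNorm z →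
      |P z| ≤ C / (supNorm z : ℝ) ^ 6 * (Real.exp (-(δ / n) * (supNorm z : ℝ)) * (1 + (supNorm z : ℝ) / n) ^ b))
    (μ ν : Fin 4) :
    ∀ r : ℕ, n ≤ r → ∀ z ∈ annulus 4 r (r + 1),
      |P z * (z μ : ℝ) * (z ν : ℝ)|
        ≤ C * ((b.factorial : ℝ) * Real.exp (δ / 2) * (2 / δ) ^ b) / ((r : ℝ) + 1) ^ 4
          * Real.exp (-(δ / 2 / n) * ((r : ℝ) + 1)) := by
  intro r hr z hz
  have hs : supNorm z = r + 1 := supNorm_eq_of_mem_sphere hz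
  have hnz : n < supNorm z := by omega
  have hsR : ((supNorm z : ℕ) : ℝ) = (r : ℝ) + 1 := by rw [hs]; push_cast; ring
  have hr1 : (0 : ℝ) < (r : ℝ) + 1 := by positivity
  have hP := hfar z hnz
  rw [hsR] at hP
  set M : ℝ := (b.factorial : ℝ) * Real.exp (δ / 2) * (2 / δ) ^ b with hM
  have hpoly : Real.exp (-(δ / n) * ((r : ℝ) + 1)) * (1 + ((r : ℝ) + 1) / n) ^ b
      ≤ M * Real.exp (-(δ / 2 / n) * ((r : ℝ) + 1)) := by
    rw [mul_comm]
    exact poly_exp_le b hδ (by omega) hr1.le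
  -- `0 ≤ C` is forced by the hypothesis at `z`
  have hC6 : 0 ≤ C / ((r : ℝ) + 1) ^ 6 := by
    have h0 : 0 ≤ C / ((r : ℝ) + 1) ^ 6 * (Real.exp (-(δ / n) * ((r : ℝ) + 1)) * (1 + ((r : ℝ) + 1) / n) ^ b) :=
      (abs_nonneg _).trans hP
    have hpos : 0 < Real.exp (-(δ / n) * ((r : ℝ) + 1)) * (1 + ((r : ℝ) + 1) / n) ^ b := by positivity
    exact nonneg_of_mul_nonneg_left h0 hpos
  have hP' : |P z| ≤ C / ((r : ℝ) + 1) ^ 6 * (M * Real.exp (-(δ / 2 / n) * ((r : ℝ) + 1))) :=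
    hP.trans (mul_le_mul_of_nonneg_left hpoly hC6)
  have hμ := abs_cast_apply_le_of_mem_shell hz μ
  have hν := abs_cast_apply_le_of_mem_shell hz ν
  rw [abs_mul, abs_mul]
  have hA0 : 0 ≤ C / ((r : ℝ) + 1) ^ 6 * (M * Real.exp (-(δ / 2 / n) * ((r : ℝ) + 1))) := (abs_nonneg _).trans hP'
  calc |P z| * |(z μ : ℝ)| * |(z ν : ℝ)|
      = |P z| * (|(z μ : ℝ)| * |(z ν : ℝ)|) := by ring
    _ ≤ (C / ((r : ℝ) + 1) ^ 6 * (M * Real.exp (-(δ / 2 / n) * ((r : ℝ) + 1)))) * (((r : ℝ) + 1) * ((r : ℝ) + 1)) :=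
        mul_le_mul hP' (mul_le_mul hμ hν (abs_nonneg _) hr1.le) (by positivity) hA0
    _ = C * M / ((r : ℝ) + 1) ^ 4 * Real.exp (-(δ / 2 / n) * ((r : ℝ) + 1)) := by
        field_simp

end Shape

/-! ## §3 Generic bookkeeping: a uniform bound on the far annular sums gives summability, the far `tsum` bound and the near∕far split -/

section Generic

variable {f : Pt → ℝ} {n : ℕ} {B : ℝ}

/-- [folklore] Any finite set of lattice points lies in a sup-norm ball containing the window. -/
theorem subset_box_max (u : Finset Pt) (n : ℕ) : u ⊆ box 4 (max n (u.sup supNorm)) :=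
  fun _ hz => mem_box_iff.mpr (le_max_of_le_right (Finset.le_sup (f := supNorm) hz))

/-- [folklore] Ball = window + far annulus, for sums: `Σ_{box 4 R} g = Σ_{box 4 n} g + Σ_{annulus 4 n R} g` (`n ≤ R`). -/
theorem sum_box_eq_sum_box_add_sum_annulus (g : Pt → ℝ) {n R : ℕ} (h : n ≤ R) :
    ∑ z ∈ box 4 R, g z = ∑ z ∈ box 4 n, g z + ∑ z ∈ annulus 4 n R, g z := by
  rw [Literature.Probability.LatticeModels.annulus, ← Finset.sum_sdiff (box_mono 4 h), add_comm]

/-- [folklore] **Uniformly bounded far annular sums of `|f|` ⟹ `f` is summable on `ℤ⁴`** (the near part `‖z‖∞ ≤ n` is a finite sum). -/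
theorem summable_of_far_sum_le (h : ∀ R : ℕ, n ≤ R → ∑ z ∈ annulus 4 n R, |f z| ≤ B) : Summable f := by
  have key : ∀ u : Finset Pt, ∑ z ∈ u, |f z| ≤ (∑ z ∈ box 4 n, |f z|) + B := by
    intro u
    obtain ⟨R, hnR, hu⟩ : ∃ R : ℕ, n ≤ R ∧ u ⊆ box 4 R := ⟨max n (u.sup supNorm), le_max_left _ _, subset_box_max u n⟩
    calc ∑ z ∈ u, |f z| ≤ ∑ z ∈ box 4 R, |f z| :=
          Finset.sum_le_sum_of_subset_of_nonneg hu fun _ _ _ => abs_nonneg _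
      _ = ∑ z ∈ box 4 n, |f z| + ∑ z ∈ annulus 4 n R, |f z| := sum_box_eq_sum_box_add_sum_annulus _ hnR
      _ ≤ ∑ z ∈ box 4 n, |f z| + B := by linarith [h R hnR]
  have habs : Summable fun z : Pt => |f z| :=
    summable_of_sum_le (c := (∑ z ∈ box 4 n, |f z|) + B) (fun _ => abs_nonneg _) key
  exact habs.of_abs

/-- [folklore] The far indicator `𝟙[‖z‖∞ > n]·f` vanishes on the window `box 4 n`. -/
theorem far_indicator_eq_zero_of_mem_box {z : Pt} (hz : z ∈ box 4 n) (f : Pt → ℝ) :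
    (if n < supNorm z then f z else 0) = 0 := by
  rw [mem_box_iff] at hz
  exact if_neg (not_lt.mpr hz)

/-- [folklore] On the far annulus the far indicator is `f` itself. -/
theorem far_indicator_eq_of_mem_annulus {R : ℕ} {z : Pt} (hz : z ∈ annulus 4 n R) (f : Pt → ℝ) :
    (if n < supNorm z then f z else 0) = f z := by
  rw [mem_annulus_iff] at hz
  exact if_pos hz.1

/-- [folklore] Ball sums of the far indicator are the far annular sums: `Σ_{box 4 R} 𝟙[‖z‖∞>n] f = Σ_{annulus 4 n R} f` (`n ≤ R`). -/
theorem sum_box_far_indicator {R : ℕ} (h : n ≤ R) (f : Pt → ℝ) :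
    ∑ z ∈ box 4 R, (if n < supNorm z then f z else 0) = ∑ z ∈ annulus 4 n R, f z := by
  rw [sum_box_eq_sum_box_add_sum_annulus _ h,
    Finset.sum_eq_zero (fun z hz => far_indicator_eq_zero_of_mem_box hz f), zero_add]
  exact Finset.sum_congr rfl fun z hz => far_indicator_eq_of_mem_annulus hz f

/-- [folklore] The far annular sums of `|𝟙[‖·‖∞>n] f|` obey the same uniform bound as those of `|f|`. -/
theorem far_sum_indicator_le (h : ∀ R : ℕ, n ≤ R → ∑ z ∈ annulus 4 n R, |f z| ≤ B) :
    ∀ R : ℕ, n ≤ R → ∑ z ∈ annulus 4 n R, |(if n < supNorm z then f z else 0)| ≤ B := fun R hR =>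
  le_of_eq_of_le (Finset.sum_congr rfl fun z hz => by rw [far_indicator_eq_of_mem_annulus hz f]) (h R hR)

/-- [folklore] **The far indicator is summable** under the uniform far bound. -/
theorem summable_far_indicator (h : ∀ R : ℕ, n ≤ R → ∑ z ∈ annulus 4 n R, |f z| ≤ B) :
    Summable fun z : Pt => (if n < supNorm z then f z else 0) :=
  summable_of_far_sum_le (far_sum_indicator_le h)

/-- [folklore] **THE FAR `tsum` BOUND**: `|Σ'_{‖z‖∞>n} f z| ≤ B` under the uniform far bound (limit of the ball sums along `tendsto_box_atTop`). -/
theorem abs_tsum_far_le_of_far_sum_le (h : ∀ R : ℕ, n ≤ R → ∑ z ∈ annulus 4 n R, |f z| ≤ B) :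
    |∑' z : Pt, (if n < supNorm z then f z else 0)| ≤ B := by
  have hs := summable_far_indicator h
  have hlim : Tendsto (fun R : ℕ => |∑ z ∈ box 4 R, (if n < supNorm z then f z else 0)|) atTop
      (𝓝 |∑' z : Pt, (if n < supNorm z then f z else 0)|) :=
    (hs.hasSum.comp tendsto_box_atTop).abs
  refine le_of_tendsto hlim ?_
  filter_upwards [eventually_ge_atTop n] with R hR
  show |∑ z ∈ box 4 R, (if n < supNorm z then f z else 0)| ≤ B
  rw [sum_box_far_indicator hR f]
  exact (Finset.abs_sum_le_sum_abs _ _).trans (h R hR)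

/-- [folklore] **THE NEAR∕FAR SPLIT** of a summable kernel on `ℤ⁴`: `Σ' f = Σ_{‖z‖∞≤n} f + Σ'_{‖z‖∞>n} f`. -/
theorem tsum_eq_sum_box_add_tsum_far (hf : Summable f) (n : ℕ) :
    ∑' z : Pt, f z = ∑ z ∈ box 4 n, f z + ∑' z : Pt, (if n < supNorm z then f z else 0) := by
  have hnear : ∀ z ∉ box 4 n, (if n < supNorm z then 0 else f z) = 0 := fun z hz => by
    rw [mem_box_iff, not_le] at hz
    exact if_pos hz
  have hN : Summable fun z : Pt => (if n < supNorm z then (0 : ℝ) else f z) := summable_of_ne_finset_zero hnear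
  have hF : Summable fun z : Pt => (if n < supNorm z then f z else 0) := by
    refine (hf.sub hN).congr fun z => ?_
    split_ifs <;> simp
  calc ∑' z : Pt, f z = ∑' z : Pt, ((if n < supNorm z then 0 else f z) + (if n < supNorm z then f z else 0)) :=
        tsum_congr fun z => by split_ifs <;> simp
    _ = ∑ z ∈ box 4 n, f z + ∑' z : Pt, (if n < supNorm z then f z else 0) := by
        rw [hN.tsum_add hF, tsum_eq_sum hnear]
        congr 1
        exact Finset.sum_congr rfl fun z hz => if_neg (not_lt.mpr (mem_box_iff.mp hz))

end Generic

/-! ## §4 The far second moment under the exponential shape: n-FREE -/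

/-- [folklore] The elementary n-free majorisation `80E(1 + n/(δ/2))/(n+1) ≤ 80E(1 + 2/δ)` (`E ≥ 0`, `δ > 0`). -/
theorem tail_const_le {E δ : ℝ} (hE : 0 ≤ E) (hδ : 0 < δ) (n : ℕ) :
    80 * E * (1 + (n : ℝ) / (δ / 2)) / ((n : ℝ) + 1) ≤ 80 * E * (1 + 2 / δ) := by
  have hn1 : (0 : ℝ) < (n : ℝ) + 1 := by positivity
  rw [div_le_iff₀ hn1]
  have h1 : 1 + (n : ℝ) / (δ / 2) ≤ (1 + 2 / δ) * ((n : ℝ) + 1) := by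
    have e : (n : ℝ) / (δ / 2) = (n : ℝ) * (2 / δ) := by
      rw [div_div_eq_mul_div]; ring
    rw [e]
    have h2 : 0 ≤ 2 / δ := by positivity
    have h3 : (0 : ℝ) ≤ n := Nat.cast_nonneg n
    nlinarith [mul_nonneg h3 h2, h2, h3]
  calc 80 * E * (1 + (n : ℝ) / (δ / 2)) ≤ 80 * E * ((1 + 2 / δ) * ((n : ℝ) + 1)) :=
        mul_le_mul_of_nonneg_left h1 (by positivity)
    _ = 80 * E * (1 + 2 / δ) * ((n : ℝ) + 1) := by ring

section Exponential

variable {P : Pt → ℝ} {C δ : ℝ} {n b : ℕ} (hC : 0 ≤ C) (hδ : 0 < δ) (hn : 1 ≤ n)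
  (hfar : ∀ z : Pt, n < supNorm z →
    |P z| ≤ C / (supNorm z : ℝ) ^ 6 * (Real.exp (-(δ / n) * (supNorm z : ℝ)) * (1 + (supNorm z : ℝ) / n) ^ b))
include hC hδ hn hfar

/-- [folklore] **THE n-FREE FAR SECOND MOMENT** (RHOA-4 (a), exponential form): under the far shape beyond the window,
`Σ_{z ∈ annulus 4 n R}|P z·z_μ·z_ν| ≤ 80·E·(1 + 2/δ)` for EVERY `R ≥ n`, `E := C·(b!·e^{δ/2}·(2/δ)^b)` — no `n` on the right. -/
theorem sum_far_abs_le (μ ν : Fin 4) {R : ℕ} (hR : n ≤ R) :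
    ∑ z ∈ annulus 4 n R, |P z * (z μ : ℝ) * (z ν : ℝ)|
      ≤ 80 * (C * ((b.factorial : ℝ) * Real.exp (δ / 2) * (2 / δ) ^ b)) * (1 + 2 / δ) := by
  set E : ℝ := C * ((b.factorial : ℝ) * Real.exp (δ / 2) * (2 / δ) ^ b) with hE
  have hE0 : 0 ≤ E := by positivity
  have hn' : (0 : ℝ) < n := by exact_mod_cast hn
  have hshell := shellBound_of_farShape hδ hn hfar μ ν
  -- the shell bound for `|K|` with `K := |P·z_μ·z_ν|`
  have h := tail_sum_le_exp (K := fun z => |P z * (z μ : ℝ) * (z ν : ℝ)|) (E := E) (δ := δ / 2) (Lr := (n : ℝ))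
    hE0 (by positivity) hn' hR (fun r hr z hz => by rw [abs_abs]; exact hshell r hr z hz)
  have hnonneg : 0 ≤ ∑ z ∈ annulus 4 n R, |P z * (z μ : ℝ) * (z ν : ℝ)| := Finset.sum_nonneg fun _ _ => abs_nonneg _
  rw [abs_of_nonneg hnonneg] at h
  exact h.trans (tail_const_le hE0 hδ n)

/-- [folklore] The signed far sum: `|Σ_{z ∈ annulus 4 n R} P z·z_μ·z_ν| ≤ 80·E·(1 + 2/δ)`. -/
theorem abs_sum_far_le (μ ν : Fin 4) {R : ℕ} (hR : n ≤ R) :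
    |∑ z ∈ annulus 4 n R, P z * (z μ : ℝ) * (z ν : ℝ)|
      ≤ 80 * (C * ((b.factorial : ℝ) * Real.exp (δ / 2) * (2 / δ) ^ b)) * (1 + 2 / δ) :=
  (Finset.abs_sum_le_sum_abs _ _).trans (sum_far_abs_le hC hδ hn hfar μ ν hR)

/-- [folklore] **SUMMABILITY OF THE SECOND-MOMENT INTEGRAND** for any kernel with the far shape (the near part is a finite sum):
`Summable (fun z ↦ P z * z_μ * z_ν)` — the `hT`-type letter of `FP/HorizontalTailAssemblyDefect`. -/
theorem summable_moment (μ ν : Fin 4) :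
    Summable fun z : Pt => P z * (z μ : ℝ) * (z ν : ℝ) :=
  summable_of_far_sum_le fun _ hR => sum_far_abs_le hC hδ hn hfar μ ν hR

/-- [folklore] The far-restricted integrand is summable. -/
theorem summable_far (μ ν : Fin 4) :
    Summable fun z : Pt => (if n < supNorm z then P z * (z μ : ℝ) * (z ν : ℝ) else 0) :=
  summable_far_indicator fun _ hR => sum_far_abs_le hC hδ hn hfar μ ν hR

/-- [folklore] **THE n-FREE FAR SECOND MOMENT AS A `tsum`**: `|Σ'_{‖z‖∞>n} P z·z_μ·z_ν| ≤ 80·E·(1 + 2/δ)`. -/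
theorem abs_tsum_far_le (μ ν : Fin 4) :
    |∑' z : Pt, (if n < supNorm z then P z * (z μ : ℝ) * (z ν : ℝ) else 0)|
      ≤ 80 * (C * ((b.factorial : ℝ) * Real.exp (δ / 2) * (2 / δ) ^ b)) * (1 + 2 / δ) :=
  abs_tsum_far_le_of_far_sum_le fun _ hR => sum_far_abs_le hC hδ hn hfar μ ν hR

/-- [folklore] **The same in an2's window currency**: with `K := P·z_μ·z_ν`, `|fullSum K − psum K n| ≤ 80·E·(1 + 2/δ)`
(`WindowIdentification.abs_fullSum_sub_psum_le` with `(E, δ, Lr, M, R) := (E, δ/2, n, n, n)`). -/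
theorem abs_fullSum_sub_psum_le_far (μ ν : Fin 4) :
    |fullSum (fun z => P z * (z μ : ℝ) * (z ν : ℝ)) - psum (fun z => P z * (z μ : ℝ) * (z ν : ℝ)) n|
      ≤ 80 * (C * ((b.factorial : ℝ) * Real.exp (δ / 2) * (2 / δ) ^ b)) * (1 + 2 / δ) := by
  set E : ℝ := C * ((b.factorial : ℝ) * Real.exp (δ / 2) * (2 / δ) ^ b) with hE
  have hE0 : 0 ≤ E := by positivity
  have hn' : (0 : ℝ) < n := by exact_mod_cast hn
  have h := abs_fullSum_sub_psum_le (K := fun z => P z * (z μ : ℝ) * (z ν : ℝ)) (E := E) (δ := δ / 2) (Lr := (n : ℝ))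
    (M := n) hE0 (by positivity) hn' (shellBound_of_farShape hδ hn hfar μ ν) le_rfl
  exact h.trans (tail_const_le hE0 hδ n)

end Exponential

/-! ## §5 The POWER variant of the far shape (`1 ≤ a`): bound `80·C` -/

/-- [folklore] The telescoping majorant `Σ_{n ≤ r < R} 1/(r+1)² ≤ 1/n − 1/R` (`1 ≤ n ≤ R`; from `1/(r+1)² ≤ 1/r − 1/(r+1)`). -/
theorem sum_Ico_inv_sq_le {n : ℕ} (hn : 1 ≤ n) {R : ℕ} (hR : n ≤ R) :
    ∑ r ∈ Finset.Ico n R, 1 / ((r : ℝ) + 1) ^ 2 ≤ 1 / (n : ℝ) - 1 / (R : ℝ) := by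
  induction R, hR using Nat.le_induction with
  | base => simp
  | succ R hnR ih =>
    rw [Finset.sum_Ico_succ_top hnR]
    have hR0 : (0 : ℝ) < R := by exact_mod_cast (lt_of_lt_of_le (Nat.lt_of_lt_of_le Nat.zero_lt_one hn) hnR)
    have hstep : 1 / ((R : ℝ) + 1) ^ 2 ≤ 1 / (R : ℝ) - 1 / ((R : ℝ) + 1) := by
      have e : 1 / (R : ℝ) - 1 / ((R : ℝ) + 1) = 1 / ((R : ℝ) * ((R : ℝ) + 1)) := by
        field_simp
        ring
      rw [e]
      exact one_div_le_one_div_of_le (by positivity) (by nlinarith)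
    push_cast
    linarith

section Power

variable {P : Pt → ℝ} {C : ℝ} {n a : ℕ} (hC : 0 ≤ C) (hn : 1 ≤ n) (ha : 1 ≤ a)
  (hfar : ∀ z : Pt, n < supNorm z → |P z| ≤ C / (supNorm z : ℝ) ^ 6 * ((n : ℝ) / supNorm z) ^ a)
include hn ha hfar

/-- [folklore] On the shell `‖z‖∞ = r+1 > n ≥ 1`, the power shape `|P z| ≤ C‖z‖∞⁻⁶·(n/‖z‖∞)^a` with `a ≥ 1` gives
`|P z·z_μ·z_ν| ≤ C·n/(r+1)⁵` (`(n/‖z‖)^a ≤ n/‖z‖` beyond the window). -/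
theorem shellBound_of_powShape (μ ν : Fin 4) :
    ∀ r : ℕ, n ≤ r → ∀ z ∈ annulus 4 r (r + 1),
      |P z * (z μ : ℝ) * (z ν : ℝ)| ≤ C * n / ((r : ℝ) + 1) ^ 5 := by
  intro r hr z hz
  have hs : supNorm z = r + 1 := supNorm_eq_of_mem_sphere hz
  have hnz : n < supNorm z := by omega
  have hsR : ((supNorm z : ℕ) : ℝ) = (r : ℝ) + 1 := by rw [hs]; push_cast; ring
  have hr1 : (0 : ℝ) < (r : ℝ) + 1 := by positivity
  have hn' : (0 : ℝ) < n := by exact_mod_cast hn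
  have hP := hfar z hnz
  rw [hsR] at hP
  have hq0 : 0 ≤ (n : ℝ) / ((r : ℝ) + 1) := by positivity
  have hq1 : (n : ℝ) / ((r : ℝ) + 1) ≤ 1 := by
    rw [div_le_one hr1]
    exact_mod_cast (show n ≤ r + 1 by omega)
  -- `0 ≤ C/(r+1)^6` is forced by the hypothesis at `z` (the power factor is positive since `n ≥ 1`)
  have hC6 : 0 ≤ C / ((r : ℝ) + 1) ^ 6 :=
    nonneg_of_mul_nonneg_left ((abs_nonneg _).trans hP) (by positivity)
  have hpow : ((n : ℝ) / ((r : ℝ) + 1)) ^ a ≤ (n : ℝ) / ((r : ℝ) + 1) := pow_le_of_le_one hq0 hq1 (by omega)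
  have hP' : |P z| ≤ C / ((r : ℝ) + 1) ^ 6 * ((n : ℝ) / ((r : ℝ) + 1)) := hP.trans (mul_le_mul_of_nonneg_left hpow hC6)
  have hμ := abs_cast_apply_le_of_mem_shell hz μ
  have hν := abs_cast_apply_le_of_mem_shell hz ν
  have hA0 : 0 ≤ C / ((r : ℝ) + 1) ^ 6 * ((n : ℝ) / ((r : ℝ) + 1)) := (abs_nonneg _).trans hP'
  rw [abs_mul, abs_mul]
  calc |P z| * |(z μ : ℝ)| * |(z ν : ℝ)|
      = |P z| * (|(z μ : ℝ)| * |(z ν : ℝ)|) := by ring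
    _ ≤ (C / ((r : ℝ) + 1) ^ 6 * ((n : ℝ) / ((r : ℝ) + 1))) * (((r : ℝ) + 1) * ((r : ℝ) + 1)) :=
        mul_le_mul hP' (mul_le_mul hμ hν (abs_nonneg _) hr1.le) (by positivity) hA0
    _ = C * n / ((r : ℝ) + 1) ^ 5 := by
        field_simp

include hC

/-- [folklore] **THE n-FREE FAR SECOND MOMENT, power form** (RHOA-4 (a), «`min(1,(n/‖z‖)^a)`», `a ≥ 1`):
`Σ_{z ∈ annulus 4 n R}|P z·z_μ·z_ν| ≤ 80·C` for every `R ≥ n ≥ 1`. -/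
theorem sum_far_abs_le_pow (μ ν : Fin 4) {R : ℕ} (hR : n ≤ R) :
    ∑ z ∈ annulus 4 n R, |P z * (z μ : ℝ) * (z ν : ℝ)| ≤ 80 * C := by
  have hn' : (0 : ℝ) < n := by exact_mod_cast hn
  have hshell := shellBound_of_powShape hn ha hfar μ ν
  have hsh : ∀ r ∈ Finset.Ico n R, shellSum (fun z => |P z * (z μ : ℝ) * (z ν : ℝ)|) r ≤ 80 * C * n * (1 / ((r : ℝ) + 1) ^ 2) := by
    intro r hr
    have hnr : n ≤ r := (Finset.mem_Ico.mp hr).1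
    have hr1 : (0 : ℝ) < (r : ℝ) + 1 := by positivity
    calc shellSum (fun z => |P z * (z μ : ℝ) * (z ν : ℝ)|) r
        ≤ ∑ _z ∈ annulus 4 r (r + 1), C * n / ((r : ℝ) + 1) ^ 5 := Finset.sum_le_sum fun z hz => hshell r hnr z hz
      _ = ((annulus 4 r (r + 1)).card : ℝ) * (C * n / ((r : ℝ) + 1) ^ 5) := by rw [Finset.sum_const, nsmul_eq_mul]
      _ ≤ 80 * ((r : ℝ) + 1) ^ 3 * (C * n / ((r : ℝ) + 1) ^ 5) :=
          mul_le_mul_of_nonneg_right (card_annulus_succ_four_le r) (by positivity)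
      _ = 80 * C * n * (1 / ((r : ℝ) + 1) ^ 2) := by
          field_simp
  calc ∑ z ∈ annulus 4 n R, |P z * (z μ : ℝ) * (z ν : ℝ)|
      = ∑ r ∈ Finset.Ico n R, shellSum (fun z => |P z * (z μ : ℝ) * (z ν : ℝ)|) r := (sum_Ico_shellSum _ hR).symm
    _ ≤ ∑ r ∈ Finset.Ico n R, 80 * C * n * (1 / ((r : ℝ) + 1) ^ 2) := Finset.sum_le_sum hsh
    _ = 80 * C * n * ∑ r ∈ Finset.Ico n R, 1 / ((r : ℝ) + 1) ^ 2 := by rw [Finset.mul_sum]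
    _ ≤ 80 * C * n * (1 / (n : ℝ) - 1 / (R : ℝ)) := mul_le_mul_of_nonneg_left (sum_Ico_inv_sq_le hn hR) (by positivity)
    _ ≤ 80 * C * n * (1 / (n : ℝ)) :=
        mul_le_mul_of_nonneg_left (by linarith [show (0 : ℝ) ≤ 1 / (R : ℝ) by positivity]) (by positivity)
    _ = 80 * C := by field_simp

/-- [folklore] Power form: `Summable (fun z ↦ P z * z_μ * z_ν)`. -/
theorem summable_moment_pow (μ ν : Fin 4) :
    Summable fun z : Pt => P z * (z μ : ℝ) * (z ν : ℝ) :=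
  summable_of_far_sum_le fun _ hR => sum_far_abs_le_pow hC hn ha hfar μ ν hR

/-- [folklore] Power form: the far-restricted integrand is summable. -/
theorem summable_far_pow (μ ν : Fin 4) :
    Summable fun z : Pt => (if n < supNorm z then P z * (z μ : ℝ) * (z ν : ℝ) else 0) :=
  summable_far_indicator fun _ hR => sum_far_abs_le_pow hC hn ha hfar μ ν hR

/-- [folklore] Power form: `|Σ'_{‖z‖∞>n} P z·z_μ·z_ν| ≤ 80·C`. -/
theorem abs_tsum_far_le_pow (μ ν : Fin 4) :
    |∑' z : Pt, (if n < supNorm z then P z * (z μ : ℝ) * (z ν : ℝ) else 0)| ≤ 80 * C :=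
  abs_tsum_far_le_of_far_sum_le fun _ hR => sum_far_abs_le_pow hC hn ha hfar μ ν hR

end Power

end Summit.QuantumFields.BalabanUV.Beta.FP.FarRegionMoment

end
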